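import Summits.CriticalPhenomena.PercolationContinuityZ3.Theorems.PercNearOneGluingNoHeavyLowerTailNineTypeLabelCert
import HarnessLib

/-!
# Label certificates with TOP goods: `e₂` of the three pairings and the weight-two part of `U′` are packed by `P(abcy)·P(a|b|c|y)`

Support file for crux `stmt-CriticalPhenomena-4575` (master-family programme; packing `U` / Conjecture W line), seat `prim-l12-p6` gen 31; memo
`run/shared/lean/prim/prim-l12/FROM-prim-l12-p6-g31-PRIMED-FAMILY.md` §11.  Cells as in `FourPointAtoms.pat4`.

`…NineTypeLabelCert` turns `prim-bnk-1` gen 19's abstract nine-type count (`NineType.card_bad_le_card_good`) into a decision procedure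
`tableOK` for packings against the AC-goods `{T : ι T ∈ {ab|cy, abcy}, ι Tᶜ = ⊥}`.  The abstract count takes ANY up-set of goods containing the forced
unions; this file is the same decision procedure for the TOP goods `{T : ι T = abcy, ι Tᶜ = ⊥}` (join conditions `upTop` instead of `upAC`):
* `TwoCopyMono.tableOKT`, `cellCount_of_tableOKT`, `goodKernel_kerT`, `packTop_of_tableOKT` — if `tableOKT P lab` then
  `Σ_{(h,l) ∈ P} cell h · cell l ≤ cell(abcy) · cell(a|b|c|y)` on every finite weighted graph, all `n`;
* **`TwoCopyMono.e2_pairings_pack`** — `c₈c₉ + c₈c₁₁ + c₉c₁₁ ≤ c₀c₁₄`: **the product of `P(abcy)` and `P(a|b|c|y)` dominates the second elementary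
  symmetric function of the three pairing probabilities `P(ab|cy), P(ac|by), P(ay|bc)`** — the four-point, pairing analogue of the shape of Gladkov's
  three-point strong Harris–Kleitman inequality (certificate `(ab|cy;ac|by), (ab|cy;ay|bc), (ac|by;ay|bc)`, labels `5,3,8`), and the universal core of
  every row in the memo's family (§1, §10);
* **`TwoCopyMono.uPR_weightTwo_pack`** — `c₈(c₁+c₂+c₅+c₆+c₉+c₁₁) + c₉c₁₁ ≤ c₀c₁₄`: the complete weight-two part of the primed packing `U′_R`
  (`= U′∘(b y)`; memo §1) is a theorem; what remains open of `U′` is exactly its eight half-weight darts.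
No sorries, no named facts; definitions `upTop`, `pairOKT`, `tableOKT`, `kerT` (decision-procedure bookkeeping); standard axioms.
-/

namespace Summit.CriticalPhenomena.PercolationContinuityZ3.Theorems

namespace TwoCopyMono

open Finset FourPointAtoms

/-! ## The table check with top goods -/

/-- Join side of a forced TOP good: every cell above `h` and `l` is `abcy`. [this work] -/
def upTop (h l : Fin 15) : Bool := decide (∀ x : Fin 15, ple h x = true → ple l x = true → x = 14)

/-- The pairwise table condition with top goods (CONT, COV as in `pairOK`; HL/HH with `upTop`). [this work] -/
def pairOKT (p p' : Fin 15 × Fin 15) (a a' : ℕ) : Bool :=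
  (!(ple p.1 p'.1 && ple p'.2 p.2) || decide ((a, a') ∈ NineType.contPairs)) &&
  !(ple p.2 p'.1 && ple p'.2 p.1) &&
  (!(NineType.hlOK a a') || (upTop p.1 p'.2 && downBot p.2 p'.1)) &&
  (!(NineType.hhOK a a') || (upTop p.1 p'.1 && downBot p.2 p'.2))

/-- **The table check of a label certificate with top goods.** [this work] -/
def tableOKT (P : Finset (Fin 15 × Fin 15)) (lab : Fin 15 × Fin 15 → ℕ) : Prop :=
  ∀ p ∈ P, (1 ≤ lab p ∧ lab p ≤ 9) ∧ ∀ p' ∈ P, pairOKT p p' (lab p) (lab p') = true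

/-- `tableOKT` is decidable. [this work] -/
instance (P : Finset (Fin 15 × Fin 15)) (lab : Fin 15 × Fin 15 → ℕ) : Decidable (tableOKT P lab) := by
  unfold tableOKT; infer_instance

/-- Unpacking `pairOKT`: CONT. [this work] -/
theorem pairOKT_cont {p p' : Fin 15 × Fin 15} {a a' : ℕ} (h : pairOKT p p' a a' = true)
    (h1 : ple p.1 p'.1 = true) (h2 : ple p'.2 p.2 = true) : (a, a') ∈ NineType.contPairs := by
  unfold pairOKT at h
  simp only [Bool.and_eq_true, Bool.or_eq_true, Bool.not_eq_true', decide_eq_true_eq, Bool.and_eq_false_iff] at h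
  rcases h.1.1.1 with hc | hc
  · rcases hc with hc | hc
    · rw [h1] at hc; exact absurd hc (by decide)
    · rw [h2] at hc; exact absurd hc (by decide)
  · exact hc

/-- Unpacking `pairOKT`: COV. [this work] -/
theorem pairOKT_cov {p p' : Fin 15 × Fin 15} {a a' : ℕ} (h : pairOKT p p' a a' = true) :
    ¬ (ple p.2 p'.1 = true ∧ ple p'.2 p.1 = true) := by
  unfold pairOKT at h
  simp only [Bool.and_eq_true, Bool.or_eq_true, Bool.not_eq_true', decide_eq_true_eq, Bool.and_eq_false_iff] at h
  rintro ⟨h1, h2⟩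
  rcases h.1.1.2 with hc | hc
  · rw [h1] at hc; exact absurd hc (by decide)
  · rw [h2] at hc; exact absurd hc (by decide)

/-- Unpacking `pairOKT`: HL. [this work] -/
theorem pairOKT_hl {p p' : Fin 15 × Fin 15} {a a' : ℕ} (h : pairOKT p p' a a' = true)
    (hok : NineType.hlOK a a' = true) :
    (∀ x : Fin 15, ple p.1 x = true → ple p'.2 x = true → x = 14) ∧
    (∀ z : Fin 15, ple z p.2 = true → ple z p'.1 = true → z = 0) := by
  unfold pairOKT at h
  simp only [Bool.and_eq_true, Bool.or_eq_true, Bool.not_eq_true'] at h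
  rcases h.1.2 with hc | ⟨hu, hd⟩
  · rw [hok] at hc; exact absurd hc (by decide)
  · unfold upTop at hu; unfold downBot at hd
    exact ⟨of_decide_eq_true hu, of_decide_eq_true hd⟩

/-- Unpacking `pairOKT`: HH. [this work] -/
theorem pairOKT_hh {p p' : Fin 15 × Fin 15} {a a' : ℕ} (h : pairOKT p p' a a' = true)
    (hok : NineType.hhOK a a' = true) :
    (∀ x : Fin 15, ple p.1 x = true → ple p'.1 x = true → x = 14) ∧
    (∀ z : Fin 15, ple z p.2 = true → ple z p'.2 = true → z = 0) := by
  unfold pairOKT at h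
  simp only [Bool.and_eq_true, Bool.or_eq_true, Bool.not_eq_true'] at h
  rcases h.2 with hc | ⟨hu, hd⟩
  · rw [hok] at hc; exact absurd hc (by decide)
  · unfold upTop at hu; unfold downBot at hd
    exact ⟨of_decide_eq_true hu, of_decide_eq_true hd⟩

/-- Table fact: `abcy` is maximal and `a|b|c|y` minimal in the refinement order `ple`. [folklore] -/
theorem top_up_bot_down : (∀ y : Fin 15, ple 14 y = true → y = 14) ∧ (∀ z : Fin 15, ple z 0 = true → z = 0) := by
  decide

/-! ## The count for monotone cell maps, top goods -/

/-- **The cell count of a top-goods certificate.**  If `tableOKT P lab`, then for every monotone map `ι` from the subsets of a finite type to the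
15 cells, `#{T : (ι T, ι Tᶜ) ∈ P} ≤ #{T : ι T = abcy ∧ ι Tᶜ = ⊥}`. [this work] -/
theorem cellCount_of_tableOKT (P : Finset (Fin 15 × Fin 15)) (lab : Fin 15 × Fin 15 → ℕ) (hP : tableOKT P lab)
    {γ : Type*} [Fintype γ] [DecidableEq γ] (ι : Finset γ → Fin 15)
    (hmono : ∀ A B : Finset γ, A ⊆ B → ple (ι A) (ι B) = true) :
    #(Finset.univ.filter fun T => (ι T, ι Tᶜ) ∈ P) ≤ #(Finset.univ.filter fun T => ι T = 14 ∧ ι Tᶜ = 0) := by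
  classical
  set 𝒯 : Finset (Finset γ) := Finset.univ.filter (fun T => (ι T, ι Tᶜ) ∈ P) with h𝒯
  set 𝔊 : Finset (Finset γ) := Finset.univ.filter (fun T => ι T = 14 ∧ ι Tᶜ = 0) with h𝔊
  have hmem : ∀ T, T ∈ 𝒯 ↔ (ι T, ι Tᶜ) ∈ P := by
    intro T; rw [h𝒯, Finset.mem_filter]; simp
  have hGmem : ∀ T, T ∈ 𝔊 ↔ ι T = 14 ∧ ι Tᶜ = 0 := by
    intro T; rw [h𝔊, Finset.mem_filter]; simp
  let θ : Finset γ → ℕ := fun T => lab (ι T, ι Tᶜ)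
  have hθ : ∀ s ∈ 𝒯, 1 ≤ θ s ∧ θ s ≤ 9 := fun s hs => (hP _ ((hmem s).1 hs)).1
  have hpc : ∀ s ∈ 𝒯, ∀ s' ∈ 𝒯, pairOKT (ι s, ι sᶜ) (ι s', ι s'ᶜ) (θ s) (θ s') = true :=
    fun s hs s' hs' => (hP _ ((hmem s).1 hs)).2 _ ((hmem s').1 hs')
  have hle_union_left : ∀ s t : Finset γ, ple (ι s) (ι (s ∪ t)) = true :=
    fun s t => hmono _ _ Finset.subset_union_left
  have hle_union_right : ∀ s t : Finset γ, ple (ι t) (ι (s ∪ t)) = true :=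
    fun s t => hmono _ _ Finset.subset_union_right
  have hle_cunion_left : ∀ s t : Finset γ, ple (ι (s ∪ t)ᶜ) (ι sᶜ) = true :=
    fun s t => hmono _ _ (Finset.compl_subset_compl.2 Finset.subset_union_left)
  have hle_cunion_right : ∀ s t : Finset γ, ple (ι (s ∪ t)ᶜ) (ι tᶜ) = true :=
    fun s t => hmono _ _ (Finset.compl_subset_compl.2 Finset.subset_union_right)
  have hcont : ∀ s ∈ 𝒯, ∀ s' ∈ 𝒯, s ⊆ s' → (θ s, θ s') ∈ NineType.contPairs := by
    intro s hs s' hs' hss'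
    exact pairOKT_cont (hpc s hs s' hs') (hmono _ _ hss') (hmono _ _ (Finset.compl_subset_compl.2 hss'))
  have hcov : ∀ s ∈ 𝒯, ∀ s' ∈ 𝒯, s ≠ s' → s ∪ s' ≠ Finset.univ := by
    intro s hs s' hs' _ hU
    apply pairOKT_cov (hpc s hs s' hs')
    have h1 : sᶜ ⊆ s' := by
      intro e he; rw [Finset.mem_compl] at he
      have : e ∈ s ∪ s' := hU ▸ Finset.mem_univ e
      rcases Finset.mem_union.1 this with h | h
      · exact absurd h he
      · exact h
    have h2 : s'ᶜ ⊆ s := by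
      intro e he; rw [Finset.mem_compl] at he
      have : e ∈ s ∪ s' := hU ▸ Finset.mem_univ e
      rcases Finset.mem_union.1 this with h | h
      · exact h
      · exact absurd h he
    exact ⟨hmono _ _ h1, hmono _ _ h2⟩
  have hG : ∀ g ∈ 𝔊, ∀ g' : Finset γ, g ⊆ g' → g' ∈ 𝔊 := by
    intro g hg g' hgg'
    rw [hGmem] at hg ⊢
    refine ⟨top_up_bot_down.1 _ ?_, top_up_bot_down.2 _ ?_⟩
    · rw [← hg.1]; exact hmono _ _ hgg'
    · rw [← hg.2]; exact hmono _ _ (Finset.compl_subset_compl.2 hgg')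
  have hHL : ∀ s ∈ 𝒯, ∀ s' ∈ 𝒯, NineType.hlOK (θ s) (θ s') = true → s ∪ s'ᶜ ∈ 𝔊 := by
    intro s hs s' hs' hok
    obtain ⟨hj, hm⟩ := pairOKT_hl (hpc s hs s' hs') hok
    rw [hGmem]
    refine ⟨hj _ (hle_union_left s s'ᶜ) (hle_union_right s s'ᶜ), hm _ (hle_cunion_left s s'ᶜ) ?_⟩
    have h := hle_cunion_right s s'ᶜ
    rw [compl_compl] at h
    exact h
  have hHH : ∀ s ∈ 𝒯, ∀ s' ∈ 𝒯, s ≠ s' → NineType.hhOK (θ s) (θ s') = true → s ∪ s' ∈ 𝔊 := by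
    intro s hs s' hs' _ hok
    obtain ⟨hj, hm⟩ := pairOKT_hh (hpc s hs s' hs') hok
    rw [hGmem]
    exact ⟨hj _ (hle_union_left s s') (hle_union_right s s'), hm _ (hle_cunion_left s s') (hle_cunion_right s s')⟩
  exact NineType.card_bad_le_card_good 𝒯 θ hθ hcont hcov 𝔊 hG hHL hHH

/-! ## The kernel of a top-goods certificate is good -/

/-- The kernel of a top-goods certificate: `[i = abcy ∧ j = ⊥] − [(i, j) ∈ P]`. [this work] -/
def kerT (P : Finset (Fin 15 × Fin 15)) (i j : Fin 15) : ℤ :=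
  (if i = 14 ∧ j = 0 then 1 else 0) - (if (i, j) ∈ P then 1 else 0)

/-- **Top-goods certificates give good kernels.** [this work] -/
theorem goodKernel_kerT (P : Finset (Fin 15 × Fin 15)) (lab : Fin 15 × Fin 15 → ℕ) (hP : tableOKT P lab) :
    GoodKernel (kerT P) := by
  classical
  refine ⟨fun γ _ _ Q hmono heqv => ?_⟩
  have hex : ∀ T : Finset γ, ∃ i : Fin 15, Q T = pp i := fun T => exists_pat_of_isEqv (heqv T)
  choose ι hι using hex
  have hle : ∀ A B : Finset γ, A ⊆ B → ple (ι A) (ι B) = true := by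
    intro A B hAB
    apply ple_of_profLE
    rw [← hι A, ← hι B]
    exact hmono A B hAB
  have hcount := cellCount_of_tableOKT P lab hP ι hle
  have hsum : (∑ T : Finset γ, liftK (kerT P) (Q T) (Q Tᶜ)) =
      (#(Finset.univ.filter fun T => ι T = 14 ∧ ι Tᶜ = 0) : ℤ) -
        (#(Finset.univ.filter fun T => (ι T, ι Tᶜ) ∈ P) : ℤ) := by
    have h1 : ∀ T : Finset γ, liftK (kerT P) (Q T) (Q Tᶜ) =
        (if ι T = 14 ∧ ι Tᶜ = 0 then (1 : ℤ) else 0) - (if (ι T, ι Tᶜ) ∈ P then (1 : ℤ) else 0) := by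
      intro T; rw [hι T, hι Tᶜ, liftK_pp]; rfl
    simp_rw [h1]
    rw [Finset.sum_sub_distrib, Finset.sum_boole, Finset.sum_boole]
  have : (#(Finset.univ.filter fun T => (ι T, ι Tᶜ) ∈ P) : ℤ) ≤
      (#(Finset.univ.filter fun T => ι T = 14 ∧ ι Tᶜ = 0) : ℤ) := by exact_mod_cast hcount
  rw [hsum]; linarith

/-! ## Law level -/

/-- Evaluation of the top-goods certificate kernel form: `Σ_{i,j} kerT P i j·cᵢ·cⱼ = c₁₄·c₀ − Σ_{p ∈ P} c_{p.1}·c_{p.2}`. [this work] -/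
theorem sum_kerT_cell (P : Finset (Fin 15 × Fin 15)) (c : Fin 15 → ℝ) :
    (∑ i : Fin 15, ∑ j : Fin 15, (kerT P i j : ℝ) * c i * c j) =
      c 14 * c 0 - ∑ p ∈ P, c p.1 * c p.2 := by
  classical
  have hsplit : ∀ i j : Fin 15, (kerT P i j : ℝ) * c i * c j =
      (if i = 14 ∧ j = 0 then c i * c j else 0) - (if (i, j) ∈ P then c i * c j else 0) := by
    intro i j; unfold kerT; push_cast; split_ifs <;> ring
  simp_rw [hsplit, Finset.sum_sub_distrib]
  congr 1
  · have h0 : ∀ i : Fin 15, (∑ j : Fin 15, if i = 14 ∧ j = 0 then c i * c j else 0) =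
        if i = 14 then c i * c 0 else 0 := by
      intro i
      by_cases hi : i = 14
      · rw [if_pos hi, Finset.sum_eq_single (0 : Fin 15)]
        · rw [if_pos ⟨hi, rfl⟩]
        · intro j _ hj; rw [if_neg]; rintro ⟨_, h⟩; exact hj h
        · intro h; exact absurd (Finset.mem_univ _) h
      · rw [if_neg hi]; exact Finset.sum_eq_zero fun j _ => by rw [if_neg]; rintro ⟨h, _⟩; exact hi h
    simp_rw [h0]
    rw [Finset.sum_ite_eq' Finset.univ (14 : Fin 15) (fun i => c i * c 0)]
    simp
  · rw [← Finset.sum_product' (f := fun i j => if (i, j) ∈ P then c i * c j else 0)]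
    rw [← Finset.sum_filter]
    have hPs : (Finset.univ ×ˢ (Finset.univ : Finset (Fin 15))).filter (fun p : Fin 15 × Fin 15 => (p.1, p.2) ∈ P) = P := by
      ext p
      simp only [Finset.mem_filter, Finset.mem_product, Finset.mem_univ, true_and, Prod.mk.eta]
    rw [hPs]

/-- **Packing inequality of a top-goods certificate, all `n`.**  If `tableOKT P lab` then for every finite weighted graph and all marked
points, `Σ_{(h,l) ∈ P} cell h · cell l ≤ cell(abcy) · cell(a|b|c|y)`. [this work] -/
theorem packTop_of_tableOKT (P : Finset (Fin 15 × Fin 15)) (lab : Fin 15 × Fin 15 → ℕ) (hP : tableOKT P lab)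
    {n : ℕ} (w : Sym2 (Fin n) → unitInterval) (a b c y : Fin n) :
    ∑ p ∈ P, cell w a b c y p.1 * cell w a b c y p.2 ≤ cell w a b c y 14 * cell w a b c y 0 := by
  have h := sum_kernel_cell_nonneg (goodKernel_kerT P lab hP) w a b c y
  rw [sum_kerT_cell P] at h
  linarith

variable {n : ℕ}

/-- **`e₂` of the three pairings is packed by the top good** (all `n`): `c₈c₉ + c₈c₁₁ + c₉c₁₁ ≤ c₀c₁₄`, i.e.
`P(ab|cy)P(ac|by) + P(ab|cy)P(ay|bc) + P(ac|by)P(ay|bc) ≤ P(abcy)·P(a|b|c|y)` on every finite weighted graph. [this work] -/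
theorem e2_pairings_pack (w : Sym2 (Fin n) → unitInterval) (a b c y : Fin n) :
    cell w a b c y 11 * cell w a b c y 9 + cell w a b c y 11 * cell w a b c y 8 + cell w a b c y 9 * cell w a b c y 8 ≤
      cell w a b c y 14 * cell w a b c y 0 := by
  have h := packTop_of_tableOKT ({(11, 9), (11, 8), (9, 8)} : Finset (Fin 15 × Fin 15))
    (fun p => if p = (11, 9) then 5 else if p = (11, 8) then 3 else 8)
    (by decide +kernel) w a b c y
  rw [Finset.sum_insert (by decide), Finset.sum_insert (by decide), Finset.sum_singleton] at h
  dsimp only at h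
  linarith

/-- **The weight-two part of `U′_R` is packed by the top good** (all `n`): `c₈(c₁+c₂+c₅+c₆+c₉+c₁₁) + c₉c₁₁ ≤ c₀c₁₄`. [this work] -/
theorem uPR_weightTwo_pack (w : Sym2 (Fin n) → unitInterval) (a b c y : Fin n) :
    cell w a b c y 8 * cell w a b c y 1 + cell w a b c y 8 * cell w a b c y 2 + cell w a b c y 8 * cell w a b c y 5 + cell w a b c y 8 * cell w a b c y 6 + cell w a b c y 8 * cell w a b c y 9 + cell w a b c y 8 * cell w a b c y 11 + cell w a b c y 11 * cell w a b c y 9 ≤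
      cell w a b c y 14 * cell w a b c y 0 := by
  have h := packTop_of_tableOKT ({(8, 1), (8, 2), (8, 5), (8, 6), (8, 9), (8, 11), (11, 9)} : Finset (Fin 15 × Fin 15))
    (fun p => if p = (8, 1) then 5 else if p = (8, 2) then 3 else if p = (8, 5) then 3 else if p = (8, 6) then 5 else if p = (8, 9) then 3 else if p = (8, 11) then 5 else 8)
    (by decide +kernel) w a b c y
  rw [Finset.sum_insert (by decide), Finset.sum_insert (by decide), Finset.sum_insert (by decide), Finset.sum_insert (by decide), Finset.sum_insert (by decide), Finset.sum_insert (by decide), Finset.sum_singleton] at h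
  dsimp only at h
  linarith

end TwoCopyMono

end Summit.CriticalPhenomena.PercolationContinuityZ3.Theorems
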